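import Summits.BirchSwinnertonDyer.Rank1Residual.X11b.CastellaErratumField
import Literature.NumberTheory.EllipticCurves.Castella2018.Section5Bookkeeping
import HarnessLib

/-!
# X11b, route R1 — the SEMISTABLE part of `ChainLocus` closed modulo the ONE open input

HONEST FRAMING (cell `b2b-bsdres`, verbatim): the goal of the cell is to DELETE the
COMBINATION-SHAPED residual classes for ALL analytic-rank `≤ 1` curves over `ℚ` — "full BSD
formula for every rank `≤ 1` curve in class C" assembled STRICTLY from published theorems — so that
the rank-`≤ 1` remainder becomes exactly the CONSTRUCTION-SHAPED classes, which are TYPED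
(missing-input `Prop`s), NOT attempted. This is not "finishing BSD". Sub-cell `b2b-bsdres-multr1-p1`,
research route R1 for X11b (Castella 2018 Thm. A re-proved along the author's erratum). CONDITIONAL;
deletes nothing; X11b stays CONSTRUCTION-SHAPED.

For SEMISTABLE `E` the two bookkeeping links (B) (Gross–Zagier paraphrase) and (C) (Tamagawa
relation) of Castella §5 are PRINTED in refereed form (Camb. J. Math. 6 (2018) §5, not touched by
the erratum) and are the named facts `Castella2018.section5_grossZagierParaphrase` /
`section5_tamagawaRelation` (`Literature/…/Castella2018/Section5Bookkeeping.lean`). Hence on the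
semistable part of `ChainLocus` — which is exactly the domain of the census's WITHDRAWN covered row
C4 (`r = 1 ∧ sst ∧ p > 3 ∧ irr ∧ mult ∧ ram`, RESIDUAL-CASES §a.1; the 56 `T-CAS` records, 26 of them
on `ChainLocus` below `2·10⁴`, job j077241) intersected with the erratum's extra hypotheses
(nonsplit `q`, `E(ℚ_p)[p] = 0`) and (ram2) — route R1 closes `BSD(E,p)` from PUBLISHED named facts
plus EXACTLY ONE open input: the display (A) = Cas18 eq. (5.3) for the Heegner points of the erratum
field, i.e. the consequence at the trivial character of the erratum's Thm. 1.1 (⇐ Fouquet–Wan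
arXiv:2107.13726 Thm. 4.41), composed with the published control theorem (Cas18 Thm. 2.3) and
`p`-adic Waldspurger formula (Cas18 Thm. 3.2) — see `CastellaErratumLinks.lean`.

* `bsdp_semistable_of_display` — for `W/ℚ` globally minimal elliptic, SEMISTABLE, on `ChainLocus`
  at `p`, with `ord_{s=1} L(E,s) = 1`: `BSD(E,p)`, from the named facts `hGZ` (Gross–Zagier 1986
  I.7.3), `hGZK` (GZK), `hSk` (Skinner 2016 Thm. C), `hmod` (modularity), `hEx`/`hCST` (Cai–Shu–Tian
  2014), `hFH` (Friedberg–Hoffstein, special case), `hGZp`/`hTam` (Castella 2018 §5, semistable) —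
  all PUBLISHED — and the single `∀`-hypothesis `hA` (OPEN).
-/

noncomputable section

open scoped Classical

open WeierstrassCurve NumberField Literature.NumberTheory.EllipticCurves
  Literature.NumberTheory.EllipticCurves.ModularForms
  Literature.NumberTheory.EllipticCurves.Rank1Residual
  Literature.NumberTheory.EllipticCurves.Rank1Residual.Typed


namespace Summit.BirchSwinnertonDyer.Rank1Residual.X11b

/-- **Route R1 on the SEMISTABLE part of `ChainLocus` (the withdrawn covered row C4 ∩ ChainLocus):
`BSD(E,p)` from PUBLISHED named facts and the ONE open input (A).** Let `W/ℚ` be globally minimal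
elliptic and semistable, `(E,p)` on `ChainLocus` (`p ≥ 5` multiplicative, `E[p]` irreducible, a
nonsplit multiplicative `q ≠ p` and a further multiplicative `ℓ ∉ {p,q}` with `E[p]` ramified at both,
`E(ℚ_p)[p] = 0`), `ord_{s=1} L(E,s) = 1`. Then Miller's `BSD(E,p)` holds, GIVEN: Gross–Zagier 1986
Thm. I.7.3 (`hGZ`), Gross–Zagier–Kolyvagin (`hGZK`), Skinner 2016 Thm. C (`hSk`), the Modularity
Theorem (`hmod`), Cai–Shu–Tian 2014 §1/Thm. 1.1 (`hEx`, `hCST`), Friedberg–Hoffstein 1995 Thm. B in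
Castella's special case (`hFH`), Castella 2018 §5's two printed relations for semistable `E` (`hGZp`,
`hTam`) — named facts, PUBLISHED — and `hA`: the display (5.3) for every Heegner point of an erratum
field — OPEN (erratum Thm. 1.1 ⇐ Fouquet–Wan Thm. 4.41; with Cas18 Thms. 2.3, 3.2). Proof = Castella
§5 verbatim: field (`erratumField_supply`), Heegner point of infinite order
(`heegnerSupply_of_caiShuTian`), minimal model of the twist and transports
(`twistTransportAt_of_twist`), then `bsdp_of_links`. CONDITIONAL on `hA`; deletes nothing.
[cite: Castella2018, §5 (arXiv:1704.06608 p. 12)] [cite: Castella2018Erratum, Thm. A′ (p. 1)] -/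
theorem bsdp_semistable_of_display
    (hGZ : GrossZagier1986_thm_I_7_3) (hGZK : rank_eq_analyticRank_of_analyticRank_le_one)
    (hSk : Skinner2016.thmC_padicValRat_bsd_rank_zero) (hmod : exists_isNewformOf)
    (hEx : CaiShuTian2014.exists_isHeegnerPoint_of_heegnerCondition)
    (hCST : CaiShuTian2014.thm11_trivialChar)
    (hFH : friedbergHoffstein_exists_twist_ne_zero_ramifiedAt)
    (hGZp : Castella2018.section5_grossZagierParaphrase)
    (hTam : Castella2018.section5_tamagawaRelation)
    (hA : ∀ (W : WeierstrassCurve ℚ) [W.IsElliptic] [W.IsGloballyMinimal] [NeZero (W.conductorNorm ℤ)]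
        (p : ℕ) [Fact p.Prime] (q : ℕ) [Fact q.Prime] (K : Type) [Field K] [NumberField K]
        (P : (W.baseChange K).toAffine.Point),
        ErratumHypotheses W p → W.analyticRank = 1 → q ≠ p → Mult W q →
        ¬ W.HasSplitMultiplicativeReductionAtPrime q → ¬ p ∣ padicValInt q W.minimalDiscriminantInt →
        IsErratumField W K q → IsHeegnerPoint (W.conductorNorm ℤ) W K P → ¬ IsOfFinAddOrder P →
        Display53At W p K P)
    (W : WeierstrassCurve ℚ) [W.IsElliptic] [W.IsGloballyMinimal] (p : ℕ) [Fact p.Prime]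
    (hsst : Semistable W) (hCL : ChainLocus W p) (hr : W.analyticRank = 1) : BSDp W p := by
  have hE : ErratumHypotheses W p := hCL.erratumHypotheses
  obtain ⟨⟨q, hqF, ℓ, hℓF, hqp, hℓp, hℓq, hmq, hnsq, hvq, hmℓ, hvℓ⟩, -⟩ := hCL.2.2.2
  haveI : NeZero (W.conductorNorm ℤ) := ⟨(W.conductorNorm_pos_holds).ne'⟩
  have hmodE : hasEntireLFunction_rat := hasEntireLFunction_rat_of_exists_isNewformOf hmod
  -- the field of §5, its Heegner point, and a globally minimal model of the twist
  obtain ⟨K, _, _, hKf⟩ := erratumField_supply hmod hFH W p q hr hmq hnsq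
  obtain ⟨P, hP, hnt⟩ := heegnerSupply_of_caiShuTian W hmodE hEx hCST hr hmq hnsq hKf
  have hd0 : (NumberField.discr K : ℚ) ≠ 0 := by exact_mod_cast NumberField.discr_ne_zero K
  haveI := W.isElliptic_quadraticTwist hd0
  obtain ⟨C, hCmin⟩ := hasGlobalMinimalModel_rat_holds (W.quadraticTwist (NumberField.discr K : ℚ))
  set Wd := C • W.quadraticTwist (NumberField.discr K : ℚ) with hWd_def
  haveI : Wd.IsGloballyMinimal := hCmin
  have hWd : ∃ C' : VariableChange ℚ, C' • W.quadraticTwist (NumberField.discr K : ℚ) = Wd :=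
    ⟨C, rfl⟩
  -- transports along the twist
  obtain ⟨htm, hti, htr⟩ := twistTransportAt_of_twist W p hKf.1 Wd hWd
  have hsp : SplitsIn K p := hKf.splitsIn_of_mult hE.2.1 (Ne.symm hqp)
  have hsℓ : SplitsIn K ℓ := hKf.splitsIn_of_mult hmℓ hℓq
  have hmultd : Mult Wd p := htm hsp hE.2.1
  have hirrd : Irr Wd p := hti hE.2.2.1
  obtain ⟨hmℓd, hvℓd⟩ := htr ℓ hℓp hsℓ hmℓ hvℓ
  have hLd : Wd.entireLFunction 1 ≠ 0 := by
    rw [hWd_def, WeierstrassCurve.entireLFunction_smul]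
    exact hKf.2.2.2.2
  -- the two PUBLISHED §5 relations, available because `E` is semistable
  have hB : GZParaphraseAt W p K P Wd := fun qv qdv hq hqd ↦
    hGZp W p q K P Wd hsst (by have := hE.1; omega) hr hE.2.2.1 hqp hmq hvq hKf.1 hKf.2.1
      hKf.2.2.1 hsp hKf.2.2.2.2 hP hnt hWd qv qdv hq hqd
  have hC : TamagawaDescentAt W p K Wd :=
    hTam W p q K Wd hsst (by have := hE.1; omega) hqp hmq hvq hKf.1 hKf.2.1 hKf.2.2.1 hWd
  exact bsdp_of_links W p hGZ hGZK hSk hE.1 hE.2.2.1 hr K hKf.1 Wd hWd hLd hmultd hirrd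
    ⟨ℓ, hℓF, hℓp, hmℓd, hvℓd⟩ P (hA W p q K P hE hr hqp hmq hnsq hvq hKf hP hnt) hB hC

end Summit.BirchSwinnertonDyer.Rank1Residual.X11b

end
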